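import Summits.QuantumFields.YangMills.Theorems.VirialFluxGapResidualTransversality
import Summits.QuantumFields.YangMills.Theorems.BalabanUVNodesN08HaarCompatibilityGuardGeodesics
import Summits.QuantumFields.YangMills.Theorems.VirialFluxGapAnchorChartSmooth
import Mathlib.Analysis.SpecialFunctions.Trigonometric.InverseDeriv
import Mathlib.Analysis.Normed.Algebra.QuaternionExponential
import Mathlib.Analysis.Calculus.LocalExtr.Basic
import Mathlib.Analysis.InnerProductSpace.Calculus
import HarnessLib

/-!
# First variation of the squared geodesic distance on `S³ = SU(2)` under conjugation, along hemisphere curves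
# (layer (B2) of the DIRECT Laplace road to ⟨stmt-QuantumFields-24204⟩ `VirialFluxGap.SharpTwistedLaplace`: calculus core of the
# covering ∕ local-surjectivity theorem for the normal slice of the diagonal conjugation action, file `…ConjSliceCovering`)

Helper module (free-hands work of width seat ym-line-sfw-p2-w2 g50, cell ym-idea-1; `--supports 24204`).  On the tree-gauged ring
space `X_fix ≅ SU(2)^I` (✓`VirialFluxGapFixGaugeAction`) the residual symmetry is the CONSTANT `SU(2)` acting by simultaneous
conjugation; in the LEFT exponential chart `u_i = exp(y_i)·q_i` at a base point `Q = (q_i)` the orbit tangent is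
`η ↦ ((1 − Ad_{q_i})η)_i` and the NORMAL (linear) SLICE is `{y | Σ_i (y_i − q̄_i y_i q_i) = 0}`.  This file is the one-variable
calculus that makes the normal slice reachable by MINIMISING the squared geodesic distance `Σ_i arccos(Re(k u_i k⁻¹ q̄_i))²` over the
compact group (next file):
* §1 quaternion bookkeeping (`⟪x, p⟫ = −Re(xp)` for imaginary `p`, conjugation is `⟪·,·⟫`-adjoint and preserves
  real ∕ imaginary parts, a unit quaternion with real part `1` is `1`, `‖Im w‖² = 1 − (Re w)²`);
* §2 the HEMISPHERE CURVE `c(t) = √(1 − t²‖η‖²)·1 + t·η` through `1` with velocity `η` (imaginary `η`): derivative, conjugate, unit norm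
  for `t²‖η‖² ≤ 1`, and the exact formula `Re(c(t) b̄ c̄(t) b) = 1 − t²(‖η‖² − ⟪η, b̄ηb⟫)` at a fixed point;
* §3 ★ `hasDerivAt_arccos_sq_conj` — for unit `a, b`, imaginary `η`, `Re(ab) ≠ −1`:
  `d/dt|₀ arccos(Re(c(t) a c̄(t) b))² = 2⟪(arccos ρ ∕ √(1−ρ²))·(Im(ab) − b Im(ab) b̄), η⟫`, `ρ = Re(ab)` — the first variation of the
  squared geodesic distance is LINEAR in the logarithm `Log(ab) = (arccos ρ ∕ √(1−ρ²))·Im(ab)` (the factor `θ∕sin θ` is produced by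
  `(arccos²)′ = −2 arccos ∕ √(1−ρ²)`); the degenerate point `ρ = 1` is a squeeze `0 ≤ arccos(ρ(t))² ≤ π²‖η‖²t²` (Jordan:
  `arccos(x)² ≤ (π²∕2)(1 − x)`, `arccos_sq_le`).
Everything here is PROVED; no definitions, no named facts (namespace `Summit.QuantumFields.YangMills.Theorems.QuantitativeLaplace`).

HONEST FRAMING: finite-dimensional calculus on `S³`; ⟨24204⟩, ⟨24319⟩, ⟨22884⟩ and every rung stay OPEN; the Yang–Mills mass gap (Clay)
is NOT touched; no summit is proved by a line.

## References
* H. Karcher, Comm. Pure Appl. Math. 30 (1977) 509–541, §1 (first variation of the squared Riemannian distance). [folklore here]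
* S. Helgason, *Groups and Geometric Analysis* (2000), Ch. I §1 Thm 1.14. [Helgason2000]
-/

set_option autoImplicit false

noncomputable section

open scoped Quaternion RealInnerProductSpace Topology BigOperators
open NormedSpace Filter Asymptotics Set
open Literature.MathematicalPhysics.QuantumFieldTheory hiding SU2 su2Quat_mul
open Literature.MathematicalPhysics.QuantumLattice
open Literature.MathematicalPhysics.QuantumFieldTheory.Balaban1983to89.T4HaarSU2Translate (su2Quat_mul su2Quat_quatToSU2
  continuous_su2Quat)
open Literature.MathematicalPhysics.QuantumFieldTheory.Balaban1983to89.T4WilsonLinkAffine (su2Quat_inv)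
open Summit.QuantumFields.YangMills.Theorems.FemtoTransferGap
open Summit.QuantumFields.YangMills.Theorems.ToronValleyVolume.Lojasiewicz (norm_sq_eq_re_sq_add_imDot)
open Summit.QuantumFields.YangMills.BalabanUVNodes.N08HaarCompatibilityGuardGeodesics (re_mul_mul_star)
open Summit.QuantumFields.YangMills.Theorems.VirialFluxGap.AnchorSlice (re_conj_unit)

namespace Summit.QuantumFields.YangMills.Theorems.QuantitativeLaplace

/-! ## §1 Quaternion bookkeeping -/

/-- For an imaginary `p`: `⟪x, p⟫ = −Re(x p)`. [folklore] -/
theorem quat_inner_eq_neg_re_mul {p : ℍ} (x : ℍ) (hp : p.re = 0) : ⟪x, p⟫ = -(x * p).re := by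
  rw [Quaternion.inner_def, Quaternion.star_eq_neg.mpr hp, mul_neg, Quaternion.re_neg]

/-- For an imaginary `p`: `Re(p x) = −⟪p, x⟫`. [folklore] -/
theorem quat_re_mul_eq_neg_inner {p : ℍ} (hp : p.re = 0) (x : ℍ) : (p * x).re = -⟪p, x⟫ := by
  have rmc : ∀ a b : ℍ, (a * b).re = (b * a).re := fun a b => by simp only [Quaternion.re_mul]; ring
  rw [real_inner_comm, quat_inner_eq_neg_re_mul x hp, rmc, neg_neg]

/-- `Re a = ⟪a, 1⟫`. [folklore] -/
theorem quat_re_eq_inner_one (a : ℍ) : a.re = ⟪a, (1 : ℍ)⟫ := by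
  rw [Quaternion.inner_def, star_one, mul_one]

/-- `star(b) m b` is imaginary for imaginary `m`. [folklore] -/
theorem quat_conj_re_eq_zero' (b : ℍ) {m : ℍ} (hm : m.re = 0) : (star b * m * b).re = 0 := by
  simpa only [star_star] using re_mul_mul_star (star b) hm

/-- Adjointness of conjugation: `⟪b m b̄, x⟫ = ⟪m, b̄ x b⟫`. [folklore] -/
theorem quat_inner_conj_left (b m x : ℍ) : ⟪b * m * star b, x⟫ = ⟪m, star b * x * b⟫ := by
  have rmc : ∀ a b : ℍ, (a * b).re = (b * a).re := fun a b => by simp only [Quaternion.re_mul]; ring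
  rw [Quaternion.inner_def, Quaternion.inner_def, star_mul, star_mul, star_star]
  rw [show b * m * star b * star x = b * (m * (star b * star x)) by simp only [mul_assoc], rmc b]
  simp only [mul_assoc]

/-- Conjugation commutes with real scalars. [folklore] -/
theorem quat_conj_smul (b m : ℍ) (r : ℝ) : star b * (r • m) * b = r • (star b * m * b) := by
  rw [mul_smul_comm, smul_mul_assoc]

/-- A unit quaternion with real part `1` is `1`. [folklore] -/
theorem quat_eq_one_of_norm_one_of_re {w : ℍ} (hw : ‖w‖ = 1) (hre : w.re = 1) : w = 1 := by
  have h := norm_sq_eq_re_sq_add_imDot w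
  rw [hw, hre] at h
  have h0 : w.imI * w.imI + w.imJ * w.imJ + w.imK * w.imK = 0 := by linarith
  have hI : w.imI = 0 := by nlinarith [mul_self_nonneg w.imI, mul_self_nonneg w.imJ, mul_self_nonneg w.imK]
  have hJ : w.imJ = 0 := by nlinarith [mul_self_nonneg w.imI, mul_self_nonneg w.imJ, mul_self_nonneg w.imK]
  have hK : w.imK = 0 := by nlinarith [mul_self_nonneg w.imI, mul_self_nonneg w.imJ, mul_self_nonneg w.imK]
  ext <;> simp [hre, hI, hJ, hK]

/-- For a unit quaternion, `‖Im w‖ = √(1 − (Re w)²)`. [folklore] -/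
theorem quat_norm_im_eq_sqrt {w : ℍ} (hw : ‖w‖ = 1) : ‖w.im‖ = Real.sqrt (1 - w.re ^ 2) := by
  have h := norm_sq_eq_re_sq_add_imDot w
  have h' := norm_sq_eq_re_sq_add_imDot w.im
  simp only [Quaternion.re_im, Quaternion.imI_im, Quaternion.imJ_im, Quaternion.imK_im] at h'
  rw [hw, one_pow] at h
  have hsq : ‖w.im‖ ^ 2 = 1 - w.re ^ 2 := by nlinarith
  rw [← hsq, Real.sqrt_sq (norm_nonneg _)]

/-- For a unit quaternion, `−1 ≤ Re w ≤ 1`. [folklore] -/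
theorem quat_abs_re_le_one {w : ℍ} (hw : ‖w‖ = 1) : |w.re| ≤ 1 := by
  have h := norm_sq_eq_re_sq_add_imDot w
  rw [hw, one_pow] at h
  rw [abs_le]
  constructor <;> nlinarith [mul_self_nonneg w.imI, mul_self_nonneg w.imJ, mul_self_nonneg w.imK]

/-! ## §2 The hemisphere curve `c(t) = √(1 − t²‖η‖²)·1 + t·η` through `1` with velocity `η` -/

/-- The hemisphere curve has velocity `η` at `t = 0`. [folklore] -/
theorem hasDerivAt_hemisphere (η : ℍ) :
    HasDerivAt (fun t : ℝ => Real.sqrt (1 - t ^ 2 * ‖η‖ ^ 2) • (1 : ℍ) + t • η) η 0 := by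
  have h1 : HasDerivAt (fun t : ℝ => 1 - t ^ 2 * ‖η‖ ^ 2) 0 0 := by
    have := ((hasDerivAt_pow 2 (0 : ℝ)).mul_const (‖η‖ ^ 2)).const_sub 1
    simpa using this
  have h2 : HasDerivAt (fun t : ℝ => Real.sqrt (1 - t ^ 2 * ‖η‖ ^ 2)) 0 0 := by
    have := h1.sqrt (by norm_num)
    simpa using this
  have h3 : HasDerivAt (fun t : ℝ => Real.sqrt (1 - t ^ 2 * ‖η‖ ^ 2) • (1 : ℍ) + t • η) ((0 : ℝ) • (1 : ℍ) + (1 : ℝ) • η) 0 :=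
    (h2.smul_const (1 : ℍ)).add ((hasDerivAt_id (0 : ℝ)).smul_const η)
  simpa only [zero_smul, one_smul, zero_add] using h3

/-- The conjugate hemisphere curve has velocity `−η`. [folklore] -/
theorem hasDerivAt_hemisphere_star (η : ℍ) :
    HasDerivAt (fun t : ℝ => Real.sqrt (1 - t ^ 2 * ‖η‖ ^ 2) • (1 : ℍ) - t • η) (-η) 0 := by
  have h1 : HasDerivAt (fun t : ℝ => 1 - t ^ 2 * ‖η‖ ^ 2) 0 0 := by
    have := ((hasDerivAt_pow 2 (0 : ℝ)).mul_const (‖η‖ ^ 2)).const_sub 1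
    simpa using this
  have h2 : HasDerivAt (fun t : ℝ => Real.sqrt (1 - t ^ 2 * ‖η‖ ^ 2)) 0 0 := by
    have := h1.sqrt (by norm_num)
    simpa using this
  have h3 : HasDerivAt (fun t : ℝ => Real.sqrt (1 - t ^ 2 * ‖η‖ ^ 2) • (1 : ℍ) - t • η) ((0 : ℝ) • (1 : ℍ) - (1 : ℝ) • η) 0 :=
    (h2.smul_const (1 : ℍ)).sub ((hasDerivAt_id (0 : ℝ)).smul_const η)
  simpa only [zero_smul, one_smul, zero_sub] using h3

/-- For imaginary `η`, the conjugate of the hemisphere curve. [folklore] -/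
theorem star_hemisphere {η : ℍ} (hη : η.re = 0) (t : ℝ) :
    star (Real.sqrt (1 - t ^ 2 * ‖η‖ ^ 2) • (1 : ℍ) + t • η) = Real.sqrt (1 - t ^ 2 * ‖η‖ ^ 2) • (1 : ℍ) - t • η := by
  have hI : (star η).imI = -η.imI := by simp
  have hJ : (star η).imJ = -η.imJ := by simp
  have hK : (star η).imK = -η.imK := by simp
  ext <;> simp [hη]

/-- For imaginary `η` and `t²‖η‖² ≤ 1` the hemisphere curve lies on the unit sphere. [folklore] -/
theorem norm_hemisphere {η : ℍ} (hη : η.re = 0) {t : ℝ} (ht : t ^ 2 * ‖η‖ ^ 2 ≤ 1) :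
    ‖Real.sqrt (1 - t ^ 2 * ‖η‖ ^ 2) • (1 : ℍ) + t • η‖ = 1 := by
  set s : ℝ := Real.sqrt (1 - t ^ 2 * ‖η‖ ^ 2) with hs
  have hs2 : s ^ 2 = 1 - t ^ 2 * ‖η‖ ^ 2 := Real.sq_sqrt (by linarith)
  have hη2 := norm_sq_eq_re_sq_add_imDot η
  rw [hη] at hη2
  have h := norm_sq_eq_re_sq_add_imDot (s • (1 : ℍ) + t • η)
  simp only [Quaternion.re_add, Quaternion.re_smul, Quaternion.re_one, hη, smul_eq_mul, mul_one, mul_zero, add_zero,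
    Quaternion.imI_add, Quaternion.imI_smul, Quaternion.imI_one, Quaternion.imJ_add, Quaternion.imJ_smul, Quaternion.imJ_one,
    Quaternion.imK_add, Quaternion.imK_smul, Quaternion.imK_one, zero_add] at h
  have h1 : ‖s • (1 : ℍ) + t • η‖ ^ 2 = 1 := by rw [h]; nlinarith
  have h0 : 0 ≤ ‖s • (1 : ℍ) + t • η‖ := norm_nonneg _
  nlinarith

/-- The real part of a conjugate along the hemisphere curve at a FIXED point: for imaginary `η`, unit `b` and `t²‖η‖² ≤ 1`,
`Re(c(t) b̄ c̄(t) b) = 1 − t²(‖η‖² − ⟪η, b̄ η b⟫)`. [folklore] -/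
theorem re_hemisphere_conj_fixed {η b : ℍ} (hη : η.re = 0) (hb : ‖b‖ = 1) {t : ℝ} (ht : t ^ 2 * ‖η‖ ^ 2 ≤ 1) :
    ((Real.sqrt (1 - t ^ 2 * ‖η‖ ^ 2) • (1 : ℍ) + t • η) * star b *
        (Real.sqrt (1 - t ^ 2 * ‖η‖ ^ 2) • (1 : ℍ) - t • η) * b).re =
      1 - t ^ 2 * (‖η‖ ^ 2 - ⟪η, star b * η * b⟫) := by
  set s : ℝ := Real.sqrt (1 - t ^ 2 * ‖η‖ ^ 2) with hs
  have hs2 : s * s = 1 - t ^ 2 * ‖η‖ ^ 2 := by rw [← sq]; exact Real.sq_sqrt (by linarith)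
  have hbb : star b * b = 1 := by
    rw [Quaternion.star_mul_self, Quaternion.normSq_eq_norm_mul_self, hb]; simp
  -- expand
  have e : (s • (1 : ℍ) + t • η) * star b * (s • (1 : ℍ) - t • η) * b =
      (s * s) • (star b * b) + (s * t) • (η * star b * b) - (s * t) • (star b * η * b) - (t * t) • (η * star b * η * b) := by
    simp only [smul_mul_assoc, mul_smul_comm, one_mul, add_mul, mul_add, sub_eq_add_neg, mul_neg, neg_mul,
      smul_add, smul_smul, mul_assoc]
    abel_nf
    simp only [mul_comm t s]
    abel
  rw [e, hbb]
  have hη1 : (η * star b * b) = η := by rw [mul_assoc, hbb, mul_one]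
  rw [hη1]
  have hconj : (star b * η * b).re = 0 := quat_conj_re_eq_zero' b hη
  have hquad : (η * star b * η * b).re = -⟪η, star b * η * b⟫ := by
    rw [show η * star b * η * b = η * (star b * η * b) by simp only [mul_assoc], quat_re_mul_eq_neg_inner hη]
  simp only [Quaternion.re_add, Quaternion.re_sub, Quaternion.re_smul, Quaternion.re_one, hη, hconj, hquad, smul_eq_mul]
  nlinarith [hs2]


/-! ## §3 First variation of the squared geodesic distance along the hemisphere curves -/

/-- Jordan-type bound: `arccos(x)² ≤ (π²/2)(1 − x)` for `x ≤ 1`. [folklore] -/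
theorem arccos_sq_le {x : ℝ} (hx : x ≤ 1) : Real.arccos x ^ 2 ≤ Real.pi ^ 2 / 2 * (1 - x) := by
  rcases lt_or_ge x (-1) with hlt | hge
  · rw [Real.arccos_of_le_neg_one hlt.le]
    nlinarith [Real.pi_pos]
  · set θ := Real.arccos x with hθ
    have hθ0 : 0 ≤ θ := Real.arccos_nonneg x
    have hθπ : θ ≤ Real.pi := Real.arccos_le_pi x
    have hcos : Real.cos θ = x := Real.cos_arccos hge hx
    have hj : 2 / Real.pi * (θ / 2) ≤ Real.sin (θ / 2) :=
      Real.mul_le_sin (by linarith) (by linarith)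
    have hs : Real.cos θ = 1 - 2 * Real.sin (θ / 2) ^ 2 := by
      rw [← Real.cos_two_mul_eq_one_sub]; ring_nf
    have hπ : 0 < Real.pi := Real.pi_pos
    have h0 : 0 ≤ 2 / Real.pi * (θ / 2) := by positivity
    have h1 : (2 / Real.pi * (θ / 2)) ^ 2 ≤ Real.sin (θ / 2) ^ 2 := by nlinarith
    have h2 : (2 / Real.pi * (θ / 2)) ^ 2 = θ ^ 2 / Real.pi ^ 2 := by
      field_simp
    rw [h2, div_le_iff₀ (by positivity)] at h1
    rw [← hcos, hs]
    nlinarith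

/-- The conjugated hemisphere product has derivative `η(ab) − aηb` at `t = 0`. [folklore] -/
theorem hasDerivAt_hemisphere_conj (a b η : ℍ) :
    HasDerivAt (fun t : ℝ => (Real.sqrt (1 - t ^ 2 * ‖η‖ ^ 2) • (1 : ℍ) + t • η) * a *
        (Real.sqrt (1 - t ^ 2 * ‖η‖ ^ 2) • (1 : ℍ) - t • η) * b) (η * (a * b) - a * η * b) 0 := by
  have h1 := (hasDerivAt_hemisphere η).mul_const a
  have h2 := h1.mul (hasDerivAt_hemisphere_star η)
  have h3 := h2.mul_const b
  have e : (η * a * (Real.sqrt (1 - (0 : ℝ) ^ 2 * ‖η‖ ^ 2) • (1 : ℍ) - (0 : ℝ) • η) +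
      (Real.sqrt (1 - (0 : ℝ) ^ 2 * ‖η‖ ^ 2) • (1 : ℍ) + (0 : ℝ) • η) * a * -η) * b = η * (a * b) - a * η * b := by
    simp; noncomm_ring
  rw [← e]
  exact h3

/-- `Re(η w) = −⟪Im w, η⟫` for imaginary `η`. [folklore] -/
theorem quat_re_mul_eq_neg_inner_im {η : ℍ} (hη : η.re = 0) (w : ℍ) : (η * w).re = -⟪w.im, η⟫ := by
  rw [Quaternion.inner_def]
  simp [Quaternion.re_mul, hη]
  ring

/-- Conjugation by a unit commutes with taking the imaginary part. [folklore] -/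
theorem quat_conj_im {b : ℍ} (hb : ‖b‖ = 1) (w : ℍ) : (b * w * star b).im = b * w.im * star b := by
  have hbb : b * star b = 1 := by
    rw [Quaternion.self_mul_star, Quaternion.normSq_eq_norm_mul_self, hb]; simp
  have h1 : (b * w * star b).im = b * w * star b - ((b * w * star b).re : ℍ) := (Quaternion.sub_re_self _).symm
  have h2 : w.im = w - (w.re : ℍ) := (Quaternion.sub_re_self _).symm
  rw [h1, h2, re_conj_unit hb, mul_sub, sub_mul, ← Quaternion.coe_commutes (w.re) b, mul_assoc (w.re : ℍ), hbb, mul_one]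

/-- The real part along the conjugated hemisphere product has derivative `−⟪Im(ab) − b Im(ab) b̄, η⟫` at `t = 0`
(`b` unit, `η` imaginary). [folklore] -/
theorem hasDerivAt_re_hemisphere_conj {b η : ℍ} (a : ℍ) (hb : ‖b‖ = 1) (hη : η.re = 0) :
    HasDerivAt (fun t : ℝ => ((Real.sqrt (1 - t ^ 2 * ‖η‖ ^ 2) • (1 : ℍ) + t • η) * a *
        (Real.sqrt (1 - t ^ 2 * ‖η‖ ^ 2) • (1 : ℍ) - t • η) * b).re) (-⟪(a * b).im - b * (a * b).im * star b, η⟫) 0 := by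
  have hbb : b * star b = 1 := by
    rw [Quaternion.self_mul_star, Quaternion.normSq_eq_norm_mul_self, hb]; simp
  have h := (hasDerivAt_hemisphere_conj a b η).inner ℝ (hasDerivAt_const (0 : ℝ) (1 : ℍ))
  simp only [inner_zero_right, zero_add] at h
  have e1 : (η * (a * b)).re = -⟪(a * b).im, η⟫ := quat_re_mul_eq_neg_inner_im hη _
  have e2 : (a * η * b).re = -⟪b * (a * b).im * star b, η⟫ := by
    have hba : b * a = b * (a * b) * star b := by
      rw [show b * (a * b) * star b = b * a * (b * star b) by noncomm_ring, hbb, mul_one]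
    have rmc : ∀ a b : ℍ, (a * b).re = (b * a).re := fun a b => by simp only [Quaternion.re_mul]; ring
    rw [show a * η * b = a * (η * b) by noncomm_ring, rmc, show η * b * a = η * (b * a) by noncomm_ring, hba,
      quat_re_mul_eq_neg_inner_im hη, quat_conj_im hb]
  have e : ⟪η * (a * b) - a * η * b, (1 : ℍ)⟫ = -⟪(a * b).im - b * (a * b).im * star b, η⟫ := by
    rw [← quat_re_eq_inner_one, Quaternion.re_sub, e1, e2, inner_sub_left]; ring
  have e3 : (fun t : ℝ => ((Real.sqrt (1 - t ^ 2 * ‖η‖ ^ 2) • (1 : ℍ) + t • η) * a *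
      (Real.sqrt (1 - t ^ 2 * ‖η‖ ^ 2) • (1 : ℍ) - t • η) * b).re) = fun t => ⟪(Real.sqrt (1 - t ^ 2 * ‖η‖ ^ 2) • (1 : ℍ) + t • η) * a *
      (Real.sqrt (1 - t ^ 2 * ‖η‖ ^ 2) • (1 : ℍ) - t • η) * b, (1 : ℍ)⟫ := funext fun t => quat_re_eq_inner_one _
  rw [e3, ← e]; exact h


/-- A neighbourhood of `0` on which the hemisphere curve stays on the unit sphere: `t²‖η‖² ≤ 1` eventually. [folklore] -/
theorem eventually_sq_mul_norm_sq_le_one (η : ℍ) : ∀ᶠ t : ℝ in 𝓝 0, t ^ 2 * ‖η‖ ^ 2 ≤ 1 := by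
  rw [Metric.eventually_nhds_iff]
  refine ⟨1 / (‖η‖ + 1), by positivity, fun t ht => ?_⟩
  rw [Real.dist_eq, sub_zero] at ht
  have hη : 0 ≤ ‖η‖ := norm_nonneg η
  have h1 : |t| * (‖η‖ + 1) < 1 := by
    have := (lt_div_iff₀ (by positivity : (0 : ℝ) < ‖η‖ + 1)).mp ht
    linarith
  have h2 : |t| * ‖η‖ ≤ |t| * (‖η‖ + 1) := by nlinarith [abs_nonneg t]
  have h3 : 0 ≤ |t| * ‖η‖ := by positivity
  have h4 : (|t| * ‖η‖) ^ 2 ≤ 1 := by nlinarith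
  calc t ^ 2 * ‖η‖ ^ 2 = (|t| * ‖η‖) ^ 2 := by rw [mul_pow, sq_abs]
    _ ≤ 1 := h4

/-- ★ **First variation of the squared geodesic distance on `S³` under conjugation.**  For unit `a, b`, imaginary `η` and
`Re(ab) ≠ −1`, along the hemisphere curve `c(t) = √(1 − t²‖η‖²) + tη`:
`d/dt|₀ arccos(Re(c(t) a c̄(t) b))² = 2⟪(arccos ρ ∕ √(1 − ρ²))·(Im(ab) − b Im(ab) b̄), η⟫`, `ρ = Re(ab)` — LINEAR in the
logarithm `Log(ab) = (arccos ρ ∕ √(1 − ρ²))·Im(ab)` (the factor `θ∕sin θ` is produced by `(arccos²)′`); at `ρ = 1` both sides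
vanish (squeeze `0 ≤ arccos(ρ(t))² ≤ π²‖η‖²t²`). [folklore] -/
theorem hasDerivAt_arccos_sq_conj {a b η : ℍ} (ha : ‖a‖ = 1) (hb : ‖b‖ = 1) (hη : η.re = 0) (hw : (a * b).re ≠ -1) :
    HasDerivAt (fun t : ℝ => Real.arccos (((Real.sqrt (1 - t ^ 2 * ‖η‖ ^ 2) • (1 : ℍ) + t • η) * a *
        (Real.sqrt (1 - t ^ 2 * ‖η‖ ^ 2) • (1 : ℍ) - t • η) * b).re) ^ 2)
      (2 * ⟪(Real.arccos (a * b).re / Real.sqrt (1 - (a * b).re ^ 2)) • ((a * b).im - b * (a * b).im * star b), η⟫) 0 := by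
  have hab1 : ‖a * b‖ = 1 := by rw [norm_mul, ha, hb, mul_one]
  have hbb : b * star b = 1 := by
    rw [Quaternion.self_mul_star, Quaternion.normSq_eq_norm_mul_self, hb]; simp
  by_cases h1 : (a * b).re = 1
  · -- degenerate case `ab = 1`: squeeze
    have hab : a * b = 1 := quat_eq_one_of_norm_one_of_re hab1 h1
    have ha' : a = star b := by
      calc a = a * (b * star b) := by rw [hbb, mul_one]
        _ = star b := by rw [← mul_assoc, hab, one_mul]
    rw [h1, Real.arccos_one, zero_div, zero_smul, inner_zero_left, mul_zero, ha']
    rw [hasDerivAt_iff_isLittleO_nhds_zero]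
    simp only [zero_add, smul_zero, sub_zero]
    have h0 : Real.arccos (((Real.sqrt (1 - (0 : ℝ) ^ 2 * ‖η‖ ^ 2) • (1 : ℍ) + (0 : ℝ) • η) * star b *
        (Real.sqrt (1 - (0 : ℝ) ^ 2 * ‖η‖ ^ 2) • (1 : ℍ) - (0 : ℝ) • η) * b).re) ^ 2 = 0 := by
      have : star b * b = 1 := by rw [Quaternion.star_mul_self, Quaternion.normSq_eq_norm_mul_self, hb]; simp
      simp [this]
    rw [h0]
    simp only [sub_zero]
    refine IsBigO.trans_isLittleO ?_ (isLittleO_pow_id (n := 2) one_lt_two)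
    refine IsBigO.of_bound (Real.pi ^ 2 * ‖η‖ ^ 2) ?_
    filter_upwards [eventually_sq_mul_norm_sq_le_one η] with t ht
    rw [re_hemisphere_conj_fixed hη hb ht, Real.norm_eq_abs, Real.norm_eq_abs, abs_of_nonneg (sq_nonneg _), abs_of_nonneg (sq_nonneg t)]
    have hcs : |⟪η, star b * η * b⟫| ≤ ‖η‖ * ‖star b * η * b‖ := abs_real_inner_le_norm _ _
    have hn : ‖star b * η * b‖ = ‖η‖ := by rw [norm_mul, norm_mul, norm_star, hb, one_mul, mul_one]
    rw [hn] at hcs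
    have hle : 1 - t ^ 2 * (‖η‖ ^ 2 - ⟪η, star b * η * b⟫) ≤ 1 := by
      nlinarith [abs_le.mp hcs, sq_nonneg t]
    have h2 := arccos_sq_le hle
    have h3 : ‖η‖ ^ 2 - ⟪η, star b * η * b⟫ ≤ 2 * ‖η‖ ^ 2 := by nlinarith [abs_le.mp hcs]
    have h4 : Real.pi ^ 2 / 2 * (1 - (1 - t ^ 2 * (‖η‖ ^ 2 - ⟪η, star b * η * b⟫))) =
        Real.pi ^ 2 / 2 * t ^ 2 * (‖η‖ ^ 2 - ⟪η, star b * η * b⟫) := by ring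
    rw [h4] at h2
    have h5 : Real.pi ^ 2 / 2 * t ^ 2 * (‖η‖ ^ 2 - ⟪η, star b * η * b⟫) ≤ Real.pi ^ 2 / 2 * t ^ 2 * (2 * ‖η‖ ^ 2) :=
      mul_le_mul_of_nonneg_left h3 (by positivity)
    linarith
  · -- non-degenerate case: chain rule
    have hd := hasDerivAt_re_hemisphere_conj a hb hη
    have harc := (Real.hasDerivAt_arccos hw h1).pow 2
    have e0 : ((Real.sqrt (1 - (0 : ℝ) ^ 2 * ‖η‖ ^ 2) • (1 : ℍ) + (0 : ℝ) • η) * a *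
        (Real.sqrt (1 - (0 : ℝ) ^ 2 * ‖η‖ ^ 2) • (1 : ℍ) - (0 : ℝ) • η) * b).re = (a * b).re := by simp
    rw [← e0] at harc
    have hc := harc.comp 0 hd
    refine hc.congr_deriv ?_
    rw [e0, real_inner_smul_left]
    simp only [Nat.cast_ofNat, Nat.add_one_sub_one, pow_one]
    ring

end Summit.QuantumFields.YangMills.Theorems.QuantitativeLaplace
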